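import Summits.ResolutionOfSingularities.ResolutionOfSingularities.Theorems.RadicialJungCleanModelsT2StepAssembly
import Summits.ResolutionOfSingularities.ResolutionOfSingularities.Theorems.RadicialJungCleanModelsCriticalSetPullback
import HarnessLib

/-!
# Route `RadicialJung`, crux `CleanModels` (stmt-15917): the T2 step from Giraud's Lemme 2.3 at
# the points over the centre alone (T2 brick B6, with B2 discharged)

Support file (OURS) for PROGRAMME-clean-dim2 / T2 (`HOME/L/res-L0-w81-pv-2/g5/T2Skeleton.lean` v2),
line `via-clean-models` of crux `DescentPerfectToAll` (stmt-0549). Nothing here is a statement of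
Hironaka's manuscript.

`…T2StepAssembly.lean` (`T2.exists_step_of_pointwise'`) assembles the skeleton's `stub_step` from
(B2) `E(π^* f) = π⁻¹ E(f)` and (2.3) "every Giraud-singular point over the centre has a strictly
smaller entry". Brick B2 is now a THEOREM (res-L0-w81-pv-2,
`derivCriticalSet_eq_preimage_of_isPointBlowupComposition_overField`, `…CriticalSetPullback.lean`),
so here the step is stated with (2.3) as its ONLY remaining input:

* `exists_step_of_lemma23` — abstract entry `F`;
* `entry_lt_of_giraud23` — the arithmetic of the skeleton's entry `2·c + δ`: Giraud's trichotomy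
  "`c′ < c`, or `c′ = c` at THE crossing point (`δ′ = 0`) over a non-crossing centre (`δ = 1`)"
  gives `2c′ + δ′ < 2c + δ` (`c < ∞`);
* `exists_step_of_trichotomy` — the step for the skeleton's concrete entry from the trichotomy
  form of Lemme 2.3 (i)–(iii) at the points over `ξ` (plus `c(ξ) < ∞`).

## References
* J. Giraud, Forme normale d'une fonction sur une surface de caractéristique positive,
  Bull. SMF 111 (1983), Lemme 2.3, Thm. 2.4. [Giraud1983]
-/

noncomputable section

set_option linter.dupNamespace false -- mandated namespace of this single-conjunct summit

open CategoryTheory AlgebraicGeometry TopologicalSpace IsLocalRing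
open Literature.AlgebraicGeometry.Resolution

namespace Summit.ResolutionOfSingularities.ResolutionOfSingularities.Theorems.RadicialJung.CleanModels.T2

open Scheme.IdealSheafData

/-- **The T2 step from Lemme 2.3 over the centre** (abstract entry `F`): for `X` integral,
regular, locally of finite type over a field `k` of characteristic `p`, of dimension `2`, `E(f)` a
strict normal crossings divisor and `ξ` a Giraud-singular point, IF every Giraud-singular point
`ξ₁` over `ξ` of the blowing up of `X` at `ξ` has `F`-entry `<` that of `ξ`, THEN the four
conjuncts of the skeleton's `stub_step` hold (B2 supplied by
`derivCriticalSet_eq_preimage_of_isPointBlowupComposition_overField`).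
[cite: Giraud1983, Lemme 2.3 and Thm. 2.4 (proof)] -/
theorem exists_step_of_lemma23 (p : ℕ) [Fact p.Prime] (k : Type) [Field k] [CharP k p]
    (X : Scheme.{0}) [IsIntegral X] (q : X ⟶ Spec (.of k)) [LocallyOfFiniteType q]
    (hreg : Scheme.IsRegular X) (hdim : topologicalKrullDim X = 2)
    (f : Γ(X, ⊤)) (hsnc : IsStrictNormalCrossingsDivisor X (derivCriticalSet X f))
    (ξ : X) (hξ : IsGiraudSingularPoint X f ξ) (F : ℕ∞ → ℕ → ℕ)
    (h23 : ∀ (X₁ : Scheme.{0}) (π : X₁ ⟶ X), IsBlowup π (vanishingIdeal ⟨{ξ}, hξ.1⟩) →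
      ∀ ξ₁ : X₁, IsGiraudSingularPoint X₁ (π.appTop f) ξ₁ → π ξ₁ = ξ →
        F (giraudColength (X₁.presheaf.stalk ξ₁) (X₁.presheaf.germ ⊤ ξ₁ trivial (π.appTop f)))
            (derivCriticalPrimes (X₁.presheaf.stalk ξ₁)
              (X₁.presheaf.germ ⊤ ξ₁ trivial (π.appTop f))).ncard <
          F (giraudColength (X.presheaf.stalk ξ) (X.presheaf.germ ⊤ ξ trivial f))
            (derivCriticalPrimes (X.presheaf.stalk ξ) (X.presheaf.germ ⊤ ξ trivial f)).ncard) :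
    ∃ (X₁ : Scheme.{0}) (π : X₁ ⟶ X), IsPointBlowupComposition (derivCriticalSet X f) π ∧
      derivCriticalSet X₁ (π.appTop f) = π.base ⁻¹' derivCriticalSet X f ∧
      IsStrictNormalCrossingsDivisor X₁ (derivCriticalSet X₁ (π.appTop f)) ∧
      ∀ (h : {x : X | IsGiraudSingularPoint X f x}.Finite)
        (h₁ : {x₁ : X₁ | IsGiraudSingularPoint X₁ (π.appTop f) x₁}.Finite),
        Multiset.IsDershowitzMannaLT
          (h₁.toFinset.val.map fun x₁ =>
            F (giraudColength (X₁.presheaf.stalk x₁) (X₁.presheaf.germ ⊤ x₁ trivial (π.appTop f)))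
              (derivCriticalPrimes (X₁.presheaf.stalk x₁)
                (X₁.presheaf.germ ⊤ x₁ trivial (π.appTop f))).ncard)
          (h.toFinset.val.map fun x =>
            F (giraudColength (X.presheaf.stalk x) (X.presheaf.germ ⊤ x trivial f))
              (derivCriticalPrimes (X.presheaf.stalk x) (X.presheaf.germ ⊤ x trivial f)).ncard) :=
  have hne : ({ξ} : Set X) ≠ Set.univ :=
    singleton_ne_univ_of_isGiraudSingularPoint (by rw [hdim]; decide) hξ
  exists_step_of_pointwise' k X q hdim f hsnc ξ hξ F
    (fun _ π hπ => derivCriticalSet_eq_preimage_of_isPointBlowupComposition_overField p k X q hreg f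
      (IsPointBlowupComposition.single π ξ hξ.1 hne hξ.2.1 hπ))
    h23

/-- **The arithmetic of the entry `2c + δ`.** If `c < ∞` and either `c₁ < c`, or `c₁ = c` with
`n₁ ≠ 1` branches at the new point and `n = 1` branch at the centre (Giraud's Lemme 2.3: equality
of colengths only at THE crossing point of `E(f′)` over a non-crossing centre), then
`2c₁ + δ₁ < 2c + δ` for `δ = if n = 1 then 1 else 0`. [cite: Giraud1983, Lemme 2.3] -/
theorem entry_lt_of_giraud23 {c c₁ : ℕ∞} {n n₁ : ℕ} (hc : c ≠ ⊤)
    (h : c₁ < c ∨ (c₁ = c ∧ n₁ ≠ 1 ∧ n = 1)) :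
    2 * c₁.toNat + (if n₁ = 1 then 1 else 0) < 2 * c.toNat + (if n = 1 then 1 else 0) := by
  rcases h with h | ⟨rfl, hn₁, hn⟩
  · have h1 : c₁.toNat < c.toNat := by
      lift c to ℕ using hc
      have hc₁ : c₁ ≠ ⊤ := ne_top_of_lt h
      lift c₁ to ℕ using hc₁
      simpa using h
    have h2 : (if n₁ = 1 then 1 else 0) ≤ 1 := by split_ifs <;> simp
    have h3 : 0 ≤ (if n = 1 then 1 else 0) := Nat.zero_le _
    omega
  · simp [hn₁, hn]

/-- **The T2 step for the skeleton's entry `2c + δ` from the trichotomy form of Lemme 2.3.** As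
`exists_step_of_lemma23`, with the concrete entry
`2 · c(ξ).toNat + (if #branches(ξ) = 1 then 1 else 0)` and the hypothesis that every
Giraud-singular `ξ₁` over `ξ` has `c(ξ₁) < c(ξ)`, or `c(ξ₁) = c(ξ)` with `ξ₁` a crossing point
(`≠ 1` branch) and `ξ` a non-crossing point (`1` branch); `c(ξ) < ∞` is assumed (true on a
regular surface as soon as `J(X, f, E(f))_ξ ≠ 0`, `giraudColength_ne_top_of_isRegularLocalRing`).
[cite: Giraud1983, Lemme 2.3 and Thm. 2.4 (proof)] -/
theorem exists_step_of_trichotomy (p : ℕ) [Fact p.Prime] (k : Type) [Field k] [CharP k p]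
    (X : Scheme.{0}) [IsIntegral X] (q : X ⟶ Spec (.of k)) [LocallyOfFiniteType q]
    (hreg : Scheme.IsRegular X) (hdim : topologicalKrullDim X = 2)
    (f : Γ(X, ⊤)) (hsnc : IsStrictNormalCrossingsDivisor X (derivCriticalSet X f))
    (ξ : X) (hξ : IsGiraudSingularPoint X f ξ)
    (hc : giraudColength (X.presheaf.stalk ξ) (X.presheaf.germ ⊤ ξ trivial f) ≠ ⊤)
    (h23 : ∀ (X₁ : Scheme.{0}) (π : X₁ ⟶ X), IsBlowup π (vanishingIdeal ⟨{ξ}, hξ.1⟩) →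
      ∀ ξ₁ : X₁, IsGiraudSingularPoint X₁ (π.appTop f) ξ₁ → π ξ₁ = ξ →
        giraudColength (X₁.presheaf.stalk ξ₁) (X₁.presheaf.germ ⊤ ξ₁ trivial (π.appTop f)) <
            giraudColength (X.presheaf.stalk ξ) (X.presheaf.germ ⊤ ξ trivial f) ∨
          (giraudColength (X₁.presheaf.stalk ξ₁) (X₁.presheaf.germ ⊤ ξ₁ trivial (π.appTop f)) =
              giraudColength (X.presheaf.stalk ξ) (X.presheaf.germ ⊤ ξ trivial f) ∧
            (derivCriticalPrimes (X₁.presheaf.stalk ξ₁)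
              (X₁.presheaf.germ ⊤ ξ₁ trivial (π.appTop f))).ncard ≠ 1 ∧
            (derivCriticalPrimes (X.presheaf.stalk ξ)
              (X.presheaf.germ ⊤ ξ trivial f)).ncard = 1)) :
    ∃ (X₁ : Scheme.{0}) (π : X₁ ⟶ X), IsPointBlowupComposition (derivCriticalSet X f) π ∧
      derivCriticalSet X₁ (π.appTop f) = π.base ⁻¹' derivCriticalSet X f ∧
      IsStrictNormalCrossingsDivisor X₁ (derivCriticalSet X₁ (π.appTop f)) ∧
      ∀ (h : {x : X | IsGiraudSingularPoint X f x}.Finite)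
        (h₁ : {x₁ : X₁ | IsGiraudSingularPoint X₁ (π.appTop f) x₁}.Finite),
        Multiset.IsDershowitzMannaLT
          (h₁.toFinset.val.map fun x₁ =>
            2 * (giraudColength (X₁.presheaf.stalk x₁)
                (X₁.presheaf.germ ⊤ x₁ trivial (π.appTop f))).toNat +
              if (derivCriticalPrimes (X₁.presheaf.stalk x₁)
                  (X₁.presheaf.germ ⊤ x₁ trivial (π.appTop f))).ncard = 1 then 1 else 0)
          (h.toFinset.val.map fun x =>
            2 * (giraudColength (X.presheaf.stalk x) (X.presheaf.germ ⊤ x trivial f)).toNat +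
              if (derivCriticalPrimes (X.presheaf.stalk x)
                  (X.presheaf.germ ⊤ x trivial f)).ncard = 1 then 1 else 0) :=
  exists_step_of_lemma23 p k X q hreg hdim f hsnc ξ hξ
    (fun c n => 2 * c.toNat + if n = 1 then 1 else 0)
    fun X₁ π hπ ξ₁ hξ₁ heq => entry_lt_of_giraud23 hc (h23 X₁ π hπ ξ₁ hξ₁ heq)

end Summit.ResolutionOfSingularities.ResolutionOfSingularities.Theorems.RadicialJung.CleanModels.T2

end
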